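import Summits.ResolutionOfSingularities.ResolutionOfSingularities.Theorems.FrobeniusLadderFInjectiveMacaulayficationFCentreE1ChartPresentation
import Summits.ResolutionOfSingularities.ResolutionOfSingularities.Theorems.FrobeniusLadderFInjectiveMacaulayficationP2d4CChar2Fan
import Summits.ResolutionOfSingularities.ResolutionOfSingularities.Theorems.FrobeniusLadderFInjectiveMacaulayficationMonomialChartPresentationPrime
import Mathlib.LinearAlgebra.Matrix.NonsingularInverse
import HarnessLib

/-!
# F4POS-1 (ii-a): THE TWO REES CHARTS OF `Bl_{(x̄, z̄′)} Spec C′` AS MONOMIAL CHARTS — tables, kernel checks, chart identities, presentations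
# (crux `FInjectiveMacaulayfication` stmt-ResolutionOfSingularities-15315, chain w45a; res-L1-w45a-plan-1 RULING R18.4 (1) (ii) «cure by the τ-centre»;
# seat res-L1-w45a-stub-2 g7; companion of `TauCentreBlowupFull` (the FULL-everywhere theorem) and `TauFloorOneNotFull` (the non-FULL locus))

[OURS · L1 W4.5a] Support file (`--supports stmt-ResolutionOfSingularities-15315 --as helper`); the `def`s are raw ℕ/ℤ TABLES (matrices, exponent lists, term
lists — data, no `Prop`, no structure); unconditional; replaces the role of NO printed item; NOT a statement of the manuscript; AI-written (AI review is
weaker than expert review).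

SETTING. `C′ = k[x,y,u,t,z′]/(f′)`, `f′ = z′² + x²z′ + x²(y³+u³+t³)` (`X 0 = x`, `X 1..3 = y,u,t`, `X 4 = z′`), `char k = 2` — res-L1-w45a-stub-1's chart ring of
p604021 (the `D(x²)`-chart of `Bl_𝔮̄ X`, `X = V(z²+x⁴z+y³+u³+t³)`), i.e. floor 1 of the τ-tower of P2d4C (res-L1-w45a-plan-1 TAU-PROBE (T1)–(T3)); the τ-centre of
floor 1 is `(x̄, z̄′)` (`TauFloorOneNotFull`). The blowing up of `Spec C′` along the MONOMIAL centre `(X₀, X₄)·C′` has two Rees charts: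
* chart A (`u_A = x̄`, `z′ = x z₁`): strict transform `g_A = z₁² + x z₁ + y³+u³+t³` — LITERALLY chart 0 of the P2d4C road-B fan (`P2d4CChar2Fan.G 0`, whose thin
  Fedder cell is kernel-checked there: the (6;2,2,2,3)-weighted chart of `X` is the composite 𝔮̄-chart ∘ τ-chart);
* chart B (`u_B = z̄′`, `x = z′x₁`): `g_B = 1 + x₁²z′ + x₁²(y³+u³+t³)` (regular everywhere).
CONTENT: §1 `isPrime_span_chart` — `(f′)` is prime (integrality transported along res-L1-w45a-stub-1's `FCentreE1ChartPresentation.exists_chartPresentation`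
`C′ ≅ R̄[I_A/x̄⁸] ⊆ R̄[1/x̄⁸]`), `mk_X_ne_zero_chart`; §2 tables `ALP AP VA VAinv VB VBinv mvA mvB avA avB dvA dvB FLc GB`, raw `decide +kernel` checks, `chart_eq_evalL`,
`gA_eq_evalL`, `gB_eq_evalL`, ★ chart identities `theta_A : θ_A f′ = x²·g_A`, `theta_B : θ_B f′ = z′²·g_B`, `hXB`, `monomial_mv`, `span_AP_eq : (x̄^{A⁺}) = (x̄, z̄′)`
(redundant generator set `A⁺ = {e₀, e₄, 2e₀, e₀+eᵢ, 2e₄, e₄+eᵢ}` — the redundancy supplies the monomial-chart engine's coordinates `hgen` for a NON-`𝔪`-primary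
centre), ★ `exists_chartEquiv : k[Y]/(g_c) ≃+* C′[(x̄,z̄′)/u_c]` (res-L1-w45a-stub-1's `MonomialChartPresentationPrime.exists_monomialChartPresentation_of_isPrime`).
HONESTY: nothing here identifies `Spec C′` with a chart of `Bl_τ X` at scheme level; nothing of [claim: Hironaka2017] is used.
[folklore; cite: CoxLittleSchenck2011, §2.3; StacksProject, Tag 0804]
-/

-- single-problem summit: the doubled namespace component is forced
set_option linter.dupNamespace false

noncomputable section

open AlgebraicGeometry CategoryTheory Literature.AlgebraicGeometry.Resolution TopologicalSpace IsLocalRing MvPolynomial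

namespace Summit.ResolutionOfSingularities.ResolutionOfSingularities.Theorems.FInjectiveMacaulayfication.TauCentreCharts

open Summit.ResolutionOfSingularities.ResolutionOfSingularities.Theorems.FInjectiveMacaulayfication
open SliceableCentre FCentreE1ChartWitness FCentreE1ChartPresentation

/-! ## §1 `(f′)` is prime; the variables survive -/

/-- `x⁸` as the monomial of stub-1's chart presentation. [plumbing] -/
theorem monomial_eight (k : Type) [Field k] :
    (monomial (Finsupp.equivFunOnFinite.symm ![8, 0, 0, 0, 0]) (1 : k) : MvPolynomial (Fin 5) k) = X 0 ^ 8 := by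
  rw [PConeFedderData.monomial_five]; simp

/-- ★ **`(f′)` IS PRIME**, `f′ = z′² + x²z′ + x²(y³+u³+t³)`, `char k = 2`: `C′ = k[X]/(f′)` injects (res-L1-w45a-stub-1's chart presentation
`FCentreE1ChartPresentation.exists_chartPresentation`) into the affine blow-up algebra `R̄[I_A/x̄⁸] ⊆ R̄[1/x̄⁸]` of the DOMAIN `R̄ = k[X]/(z²+x⁴z+y³+u³+t³)`.
[folklore] -/
theorem isPrime_span_chart (k : Type) [Field k] [CharP k 2] (F' : MvPolynomial (Fin 5) k)
    (hF : F' = X 4 ^ 2 + X 0 ^ 2 * X 4 + X 0 ^ 2 * (X 1 ^ 3 + X 2 ^ 3 + X 3 ^ 3)) : (Ideal.span {F'}).IsPrime := by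
  set f : MvPolynomial (Fin 5) k := X 4 ^ 2 + X 0 ^ 4 * X 4 + X 1 ^ 3 + X 2 ^ 3 + X 3 ^ 3 with hf
  haveI hfp : (Ideal.span {f}).IsPrime := (Ideal.span_singleton_prime (prime_f k f hf).ne_zero).mpr (prime_f k f hf)
  haveI : IsDomain (MvPolynomial (Fin 5) k ⧸ Ideal.span {f}) := Ideal.Quotient.isDomain _
  obtain ⟨e, hbij, -⟩ := exists_chartPresentation k f F' hf hF
  have hx : Ideal.Quotient.mk (Ideal.span {f}) (X 0) ≠ 0 :=
    mk_X_ne_zero_of_eval k f hfp 0 (Pi.single 1 1) (by simp) (by rw [hf]; simp)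
  have hu : Ideal.Quotient.mk (Ideal.span {f}) (monomial (Finsupp.equivFunOnFinite.symm ![8, 0, 0, 0, 0]) (1 : k)) ≠ 0 := by
    rw [monomial_eight, map_pow]
    exact pow_ne_zero 8 hx
  haveI : IsDomain (Localization.Away (Ideal.Quotient.mk (Ideal.span {f}) (monomial (Finsupp.equivFunOnFinite.symm ![8, 0, 0, 0, 0]) (1 : k)))) :=
    IsLocalization.isDomain_localization (powers_le_nonZeroDivisors_of_noZeroDivisors hu)
  have hdom : IsDomain (MvPolynomial (Fin 5) k ⧸ Ideal.span {F'}) := Function.Injective.isDomain e hbij.1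
  exact (Ideal.Quotient.isDomain_iff_prime _).mp hdom

/-- The five variables are non-zero in `C′` (`f′(0,0,0,0,1) = 1`, `f′(1,1,0,0,0) = 1`). [folklore] -/
theorem mk_X_ne_zero_chart (k : Type) [Field k] [CharP k 2] (F' : MvPolynomial (Fin 5) k)
    (hF : F' = X 4 ^ 2 + X 0 ^ 2 * X 4 + X 0 ^ 2 * (X 1 ^ 3 + X 2 ^ 3 + X 3 ^ 3)) :
    ∀ j : Fin 5, Ideal.Quotient.mk (Ideal.span {F'}) (X j) ≠ 0 := by
  have hprime := isPrime_span_chart k F' hF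
  intro j
  by_cases hj : j = 4
  · subst hj
    exact mk_X_ne_zero_of_eval k F' hprime 4 ![1, 1, 0, 0, 0] (by simp) (by rw [hF]; simp)
  · refine mk_X_ne_zero_of_eval k F' hprime j (Pi.single 4 1) (by simp [hj]) ?_
    rw [hF]; simp

/-! ## §2 The two Rees charts of `Bl_{(x̄, z̄′)} Spec C′` as monomial charts -/

/-- The redundant generator exponents `A⁺` of the centre `(X₀, X₄)` (all of `X₀, X₄, X₀², X₀Xᵢ, X₄², X₄Xᵢ` — the SAME ideal; the redundancy supplies the
chart coordinates `hgen` of the monomial-chart engine for a non-`𝔪`-primary centre). -/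
def ALP : List (Fin 5 → ℕ) :=
  [![1, 0, 0, 0, 0], ![0, 0, 0, 0, 1], ![2, 0, 0, 0, 0], ![1, 1, 0, 0, 0], ![1, 0, 1, 0, 0], ![1, 0, 0, 1, 0],
    ![0, 0, 0, 0, 2], ![0, 1, 0, 0, 1], ![0, 0, 1, 0, 1], ![0, 0, 0, 1, 1]]

/-- `A⁺` as a `Finset` of exponents. -/
def AP : Finset (Fin 5 →₀ ℕ) := (ALP.map fun u => (Finsupp.equivFunOnFinite.symm u : Fin 5 →₀ ℕ)).toFinset

/-- Chart A (`z′ = x z₁`): `θ_A X₄ = X₀X₄`, the other variables fixed. -/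
def VA : Matrix (Fin 5) (Fin 5) ℕ := !![1, 0, 0, 0, 1; 0, 1, 0, 0, 0; 0, 0, 1, 0, 0; 0, 0, 0, 1, 0; 0, 0, 0, 0, 1]

/-- Integer inverse of `VA`. -/
def VAinv : Matrix (Fin 5) (Fin 5) ℤ := !![1, 0, 0, 0, -1; 0, 1, 0, 0, 0; 0, 0, 1, 0, 0; 0, 0, 0, 1, 0; 0, 0, 0, 0, 1]

/-- Chart B (`x = z′ x₁`): `θ_B X₀ = X₀X₄`, the other variables fixed. -/
def VB : Matrix (Fin 5) (Fin 5) ℕ := !![1, 0, 0, 0, 0; 0, 1, 0, 0, 0; 0, 0, 1, 0, 0; 0, 0, 0, 1, 0; 1, 0, 0, 0, 1]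

/-- Integer inverse of `VB`. -/
def VBinv : Matrix (Fin 5) (Fin 5) ℤ := !![1, 0, 0, 0, 0; 0, 1, 0, 0, 0; 0, 0, 1, 0, 0; 0, 0, 0, 1, 0; -1, 0, 0, 0, 1]

/-- Vertex of chart A: `u_A = x̄`. -/
def mvA : Fin 5 → ℕ := ![1, 0, 0, 0, 0]

/-- Vertex of chart B: `u_B = z̄′`. -/
def mvB : Fin 5 → ℕ := ![0, 0, 0, 0, 1]

/-- Neighbours of chart A (`VA (avA i) = VA mvA + eᵢ`). -/
def avA : Fin 5 → (Fin 5 → ℕ) := ![![2, 0, 0, 0, 0], ![1, 1, 0, 0, 0], ![1, 0, 1, 0, 0], ![1, 0, 0, 1, 0], ![0, 0, 0, 0, 1]]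

/-- Neighbours of chart B (`VB (avB i) = VB mvB + eᵢ`). -/
def avB : Fin 5 → (Fin 5 → ℕ) := ![![1, 0, 0, 0, 0], ![0, 1, 0, 0, 1], ![0, 0, 1, 0, 1], ![0, 0, 0, 1, 1], ![0, 0, 0, 0, 2]]

/-- Exceptional shift of chart A: `θ_A f′ = x² · g_A`. -/
def dvA : Fin 5 → ℕ := ![2, 0, 0, 0, 0]

/-- Exceptional shift of chart B: `θ_B f′ = z′² · g_B`. -/
def dvB : Fin 5 → ℕ := ![0, 0, 0, 0, 2]

/-- `f′` as a term list (order: `z′², x²z′, x²y³, x²u³, x²t³`). -/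
def FLc : List (ℤ × (Fin 5 → ℕ)) :=
  [((1 : ℤ), ![0, 0, 0, 0, 2]), ((1 : ℤ), ![2, 0, 0, 0, 1]), ((1 : ℤ), ![2, 3, 0, 0, 0]), ((1 : ℤ), ![2, 0, 3, 0, 0]), ((1 : ℤ), ![2, 0, 0, 3, 0])]

/-- `g_B = 1 + x₁²z′ + x₁²y³ + x₁²u³ + x₁²t³` as a term list, aligned with `FLc` under `θ_B`. -/
def GB : List (ℤ × (Fin 5 → ℕ)) :=
  [((1 : ℤ), ![0, 0, 0, 0, 0]), ((1 : ℤ), ![2, 0, 0, 0, 1]), ((1 : ℤ), ![2, 3, 0, 0, 0]), ((1 : ℤ), ![2, 0, 3, 0, 0]), ((1 : ℤ), ![2, 0, 0, 3, 0])]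

/-- `VAinv · VA = 1`. -/
theorem hVA_raw : VAinv * VA.map (Nat.cast : ℕ → ℤ) = 1 := by decide +kernel

/-- `VBinv · VB = 1`. -/
theorem hVB_raw : VBinv * VB.map (Nat.cast : ℕ → ℤ) = 1 := by decide +kernel

/-- (hgen) for chart A on raw vectors. -/
theorem hgenA_raw : ∀ i : Fin 5, VA.mulVec (avA i) = VA.mulVec mvA + Pi.single i 1 := by decide +kernel

/-- (hgen) for chart B on raw vectors. -/
theorem hgenB_raw : ∀ i : Fin 5, VB.mulVec (avB i) = VB.mulVec mvB + Pi.single i 1 := by decide +kernel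

/-- (h≥) for chart A on raw vectors. -/
theorem hgeA_raw : ∀ v ∈ ALP, ∀ i : Fin 5, VA.mulVec mvA i ≤ VA.mulVec v i := by decide +kernel

/-- (h≥) for chart B on raw vectors. -/
theorem hgeB_raw : ∀ v ∈ ALP, ∀ i : Fin 5, VB.mulVec mvB i ≤ VB.mulVec v i := by decide +kernel

/-- The neighbours lie in `A⁺`. -/
theorem havA_raw : ∀ i : Fin 5, avA i ∈ ALP := by decide +kernel

/-- The neighbours lie in `A⁺`. -/
theorem havB_raw : ∀ i : Fin 5, avB i ∈ ALP := by decide +kernel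

/-- `θ_A` termwise: `VA · e = dvA + e′` along `FLc ↦ P2d4CChar2Fan.G 0` (chart A's strict transform IS chart 0 of the P2d4C fan). -/
theorem hθA_raw : List.Forall₂ (fun t t' : ℤ × (Fin 5 → ℕ) => t.1 = t'.1 ∧ VA.mulVec t.2 = dvA + t'.2) FLc (P2d4CChar2Fan.G 0) := by
  decide +kernel

/-- `θ_B` termwise: `VB · e = dvB + e′` along `FLc ↦ GB`. -/
theorem hθB_raw : List.Forall₂ (fun t t' : ℤ × (Fin 5 → ℕ) => t.1 = t'.1 ∧ VB.mulVec t.2 = dvB + t'.2) FLc GB := by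
  decide +kernel

/-- No variable divides `g_B` (its constant term is `1`). -/
theorem hXB_raw : ∀ i : Fin 5, ∃ t ∈ GB, t.2 i = 0 ∧
    ¬ ((2 : ℤ) ∣ ((GB.filter fun s : ℤ × (Fin 5 → ℕ) => s.2 = t.2).map fun s : ℤ × (Fin 5 → ℕ) => s.1).sum) := by
  decide +kernel

/-- `f′` is the value of `FLc`. [plumbing] -/
theorem chart_eq_evalL (k : Type) [Field k] (F' : MvPolynomial (Fin 5) k)
    (hF : F' = X 4 ^ 2 + X 0 ^ 2 * X 4 + X 0 ^ 2 * (X 1 ^ 3 + X 2 ^ 3 + X 3 ^ 3)) : F' = KLocCellKit.evalL k FLc := by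
  rw [hF]
  simp only [KLocCellKit.evalL, FLc, List.map_cons, List.map_nil, List.sum_cons, List.sum_nil, Int.cast_one,
    PConeFedderData.monomial_five]
  ring

/-- `g_A = z₁² + x z₁ + y³ + u³ + t³` is the value of `P2d4CChar2Fan.G 0`. [plumbing] -/
theorem gA_eq_evalL (k : Type) [Field k] :
    (X 4 ^ 2 + X 0 * X 4 + X 1 ^ 3 + X 2 ^ 3 + X 3 ^ 3 : MvPolynomial (Fin 5) k) = KLocCellKit.evalL k (P2d4CChar2Fan.G 0) := by
  simp only [KLocCellKit.evalL, P2d4CChar2Fan.G, Matrix.cons_val_zero, List.map_cons, List.map_nil, List.sum_cons, List.sum_nil,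
    Int.cast_one, PConeFedderData.monomial_five]
  ring

/-- `g_B = 1 + x₁²z′ + x₁²(y³+u³+t³)` is the value of `GB`. [plumbing] -/
theorem gB_eq_evalL (k : Type) [Field k] :
    (1 + X 0 ^ 2 * X 4 + X 0 ^ 2 * (X 1 ^ 3 + X 2 ^ 3 + X 3 ^ 3) : MvPolynomial (Fin 5) k) = KLocCellKit.evalL k GB := by
  simp only [KLocCellKit.evalL, GB, List.map_cons, List.map_nil, List.sum_cons, List.sum_nil, Int.cast_one,
    PConeFedderData.monomial_five]
  ring

/-- ★ **THE CHART IDENTITY A**: `f′(x, y, u, t, x z₁) = x² · g_A`. [folklore; cite: CoxLittleSchenck2011, §2.3] -/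
theorem theta_A (k : Type) [Field k] (F' : MvPolynomial (Fin 5) k)
    (hF : F' = X 4 ^ 2 + X 0 ^ 2 * X 4 + X 0 ^ 2 * (X 1 ^ 3 + X 2 ^ 3 + X 3 ^ 3)) :
    aeval (fun j : Fin 5 => ∏ i : Fin 5, (X i : MvPolynomial (Fin 5) k) ^ VA i j) F' =
      monomial (Finsupp.equivFunOnFinite.symm dvA) (1 : k) * KLocCellKit.evalL k (P2d4CChar2Fan.G 0) := by
  rw [chart_eq_evalL k F' hF]
  exact CIPolyKit.theta_evalL VA dvA FLc (P2d4CChar2Fan.G 0) hθA_raw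

/-- ★ **THE CHART IDENTITY B**: `f′(z′x₁, y, u, t, z′) = z′² · g_B`. [folklore; cite: CoxLittleSchenck2011, §2.3] -/
theorem theta_B (k : Type) [Field k] (F' : MvPolynomial (Fin 5) k)
    (hF : F' = X 4 ^ 2 + X 0 ^ 2 * X 4 + X 0 ^ 2 * (X 1 ^ 3 + X 2 ^ 3 + X 3 ^ 3)) :
    aeval (fun j : Fin 5 => ∏ i : Fin 5, (X i : MvPolynomial (Fin 5) k) ^ VB i j) F' =
      monomial (Finsupp.equivFunOnFinite.symm dvB) (1 : k) * KLocCellKit.evalL k GB := by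
  rw [chart_eq_evalL k F' hF]
  exact CIPolyKit.theta_evalL VB dvB FLc GB hθB_raw

/-- No variable divides `g_B`. [folklore] -/
theorem hXB (k : Type) [Field k] [CharP k 2] : ∀ i : Fin 5, ¬ (X i ∣ KLocCellKit.evalL k GB) := by
  unfold KLocCellKit.evalL
  exact NotDvdOfSupport.forall_not_X_dvd_evalL 2 GB hXB_raw

/-- `x̄ = mk (x^{mvA})`, `z̄′ = mk (x^{mvB})`. [plumbing] -/
theorem monomial_mv (k : Type) [Field k] :
    (monomial (Finsupp.equivFunOnFinite.symm mvA) (1 : k) : MvPolynomial (Fin 5) k) = X 0 ∧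
      (monomial (Finsupp.equivFunOnFinite.symm mvB) (1 : k) : MvPolynomial (Fin 5) k) = X 4 := by
  constructor
  · rw [mvA, PConeFedderData.monomial_five]; simp
  · rw [mvB, PConeFedderData.monomial_five]; simp

/-- **The redundant monomial generators span the centre**: `(x̄^{A⁺}) = (x̄, z̄′)` in `C′`. [folklore] -/
theorem span_AP_eq (k : Type) [Field k] (F' : MvPolynomial (Fin 5) k) :
    Ideal.span ((fun e : Fin 5 →₀ ℕ => Ideal.Quotient.mk (Ideal.span {F'}) (monomial e (1 : k))) '' (AP : Set (Fin 5 →₀ ℕ))) =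
      Ideal.span ({Ideal.Quotient.mk (Ideal.span {F'}) (X 0), Ideal.Quotient.mk (Ideal.span {F'}) (X 4)} :
        Set (MvPolynomial (Fin 5) k ⧸ Ideal.span {F'})) := by
  set mk := Ideal.Quotient.mk (Ideal.span {F'})
  have hx : mk (X 0) ∈ Ideal.span ({mk (X 0), mk (X 4)} : Set (MvPolynomial (Fin 5) k ⧸ Ideal.span {F'})) :=
    Ideal.subset_span (Or.inl rfl)
  have hz : mk (X 4) ∈ Ideal.span ({mk (X 0), mk (X 4)} : Set (MvPolynomial (Fin 5) k ⧸ Ideal.span {F'})) :=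
    Ideal.subset_span (Or.inr rfl)
  apply le_antisymm
  · rw [Ideal.span_le]
    rintro _ ⟨e, he, rfl⟩
    obtain ⟨v, hv, rfl⟩ := Q6CNKit.exists_of_mem_image_symm ALP e he
    simp only [ALP, List.mem_cons, List.not_mem_nil, or_false] at hv
    rw [SetLike.mem_coe]
    dsimp only
    rcases hv with rfl | rfl | rfl | rfl | rfl | rfl | rfl | rfl | rfl | rfl <;>
      rw [PConeFedderData.monomial_five] <;> simp only [pow_zero, pow_one, mul_one, one_mul, map_mul, map_pow]
    · exact hx
    · exact hz
    · exact Ideal.pow_mem_of_mem _ hx 2 (by norm_num)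
    · exact Ideal.mul_mem_right _ _ hx
    · exact Ideal.mul_mem_right _ _ hx
    · exact Ideal.mul_mem_right _ _ hx
    · exact Ideal.pow_mem_of_mem _ hz 2 (by norm_num)
    · exact Ideal.mul_mem_left _ _ hz
    · exact Ideal.mul_mem_left _ _ hz
    · exact Ideal.mul_mem_left _ _ hz
  · rw [Ideal.span_le]
    rintro r hr
    rcases hr with rfl | rfl
    · refine Ideal.subset_span ⟨Finsupp.equivFunOnFinite.symm mvA, ?_, by dsimp only; rw [(monomial_mv k).1]⟩
      exact Finset.mem_coe.mpr ((Q6CNKit.mem_image_symm ALP mvA).mpr (by decide))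
    · refine Ideal.subset_span ⟨Finsupp.equivFunOnFinite.symm mvB, ?_, by dsimp only; rw [(monomial_mv k).2]⟩
      exact Finset.mem_coe.mpr ((Q6CNKit.mem_image_symm ALP mvB).mpr (by decide))

set_option maxHeartbeats 800000 in
-- budget: the blow-up algebra / Rees chart types make unification expensive (as in `E8Char5FiModel`, `StrictTransformChartN`)
/-- **THE TWO CHART PRESENTATIONS**: for `c ∈ {A, B}`, a ring isomorphism `k[Y]/(g_c) ≃+* C′[(x̄,z̄′)/u_c]` onto the affine blow-up algebra of the centre at
`u_A = x̄`, `u_B = z̄′` (res-L1-w45a-stub-1's `MonomialChartPresentationPrime.exists_monomialChartPresentation_of_isPrime` on the redundant generator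
set `A⁺`, then `(x̄^{A⁺}) = (x̄, z̄′)`). [folklore; cite: CoxLittleSchenck2011, §2.3; StacksProject, Tag 0804] -/
theorem exists_chartEquiv (k : Type) [Field k] [CharP k 2] (F' : MvPolynomial (Fin 5) k)
    (hF : F' = X 4 ^ 2 + X 0 ^ 2 * X 4 + X 0 ^ 2 * (X 1 ^ 3 + X 2 ^ 3 + X 3 ^ 3))
    (V : Matrix (Fin 5) (Fin 5) ℕ) (hV : IsUnit (V.map (Nat.cast : ℕ → ℤ)).det) (mv : Fin 5 → ℕ) (av : Fin 5 → (Fin 5 → ℕ))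
    (hgen_raw : ∀ i : Fin 5, V.mulVec (av i) = V.mulVec mv + Pi.single i 1) (hav : ∀ i : Fin 5, av i ∈ ALP)
    (hge_raw : ∀ v ∈ ALP, ∀ i : Fin 5, V.mulVec mv i ≤ V.mulVec v i) (dv : Fin 5 → ℕ) (g : MvPolynomial (Fin 5) k)
    (hθ : aeval (fun j : Fin 5 => ∏ i : Fin 5, (X i : MvPolynomial (Fin 5) k) ^ V i j) F' =
      monomial (Finsupp.equivFunOnFinite.symm dv) (1 : k) * g)
    (hcop : ∀ i : Fin 5, ¬ (X i ∣ g)) :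
    Nonempty ((MvPolynomial (Fin 5) k ⧸ Ideal.span {g}) ≃+*
      ↥(blowupAlgebra (Ideal.span ({Ideal.Quotient.mk (Ideal.span {F'}) (X 0), Ideal.Quotient.mk (Ideal.span {F'}) (X 4)} :
          Set (MvPolynomial (Fin 5) k ⧸ Ideal.span {F'})))
        (Ideal.Quotient.mk (Ideal.span {F'}) (monomial (Finsupp.equivFunOnFinite.symm mv) (1 : k))))) := by
  have hprime := isPrime_span_chart k F' hF
  obtain ⟨e₁, hbij, -⟩ := MonomialChartPresentationPrime.exists_monomialChartPresentation_of_isPrime F' V hV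
    (Finsupp.equivFunOnFinite.symm mv) (fun i => Finsupp.equivFunOnFinite.symm (av i))
    (fun i => Q6CNKit.hgen_of_vec V (av i) mv i (hgen_raw i)) AP
    (fun i => (Q6CNKit.mem_image_symm ALP (av i)).mpr (hav i)) (Q6CNKit.hge_of_vec V ALP mv hge_raw)
    (Finsupp.equivFunOnFinite.symm dv) g hθ hprime (mk_X_ne_zero_chart k F' hF) hcop
  have hB : blowupAlgebra (Ideal.span ((fun e : Fin 5 →₀ ℕ => Ideal.Quotient.mk (Ideal.span {F'}) (monomial e (1 : k))) ''
        (AP : Set (Fin 5 →₀ ℕ)))) (Ideal.Quotient.mk (Ideal.span {F'}) (monomial (Finsupp.equivFunOnFinite.symm mv) (1 : k))) =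
      blowupAlgebra (Ideal.span ({Ideal.Quotient.mk (Ideal.span {F'}) (X 0), Ideal.Quotient.mk (Ideal.span {F'}) (X 4)} :
          Set (MvPolynomial (Fin 5) k ⧸ Ideal.span {F'})))
        (Ideal.Quotient.mk (Ideal.span {F'}) (monomial (Finsupp.equivFunOnFinite.symm mv) (1 : k))) := by
    rw [span_AP_eq]
  exact ⟨(RingEquiv.ofBijective e₁ hbij).trans (Subalgebra.equivOfEq _ _ hB).toRingEquiv⟩

end Summit.ResolutionOfSingularities.ResolutionOfSingularities.Theorems.FInjectiveMacaulayfication.TauCentreCharts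

end
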